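import Literature.Combinatorics.Optimization.PsdLiftSlackMatrix
import Literature.Combinatorics.Optimization.SmallPsdLiftExtremePoints
import Literature.Combinatorics.Optimization.PsdLiftFaceChains
import Literature.Analysis.Convex.PolarsOfConvexSets
import Literature.Analysis.Convex.CompactConvexExtremePoints
import Literature.Analysis.Convex.CubeOctahedronDuality
import HarnessLib

/-!
# Psd lifts of convex bodies and psd factorizations of the slack operator
# (Gouveia–Parrilo–Thomas 2013, Theorem 2.4, Corollary 2.6 and Proposition 2.8 (2) for `K = S^k_+`) — PROVED

Source: J. Gouveia, P. A. Parrilo, R. R. Thomas, *Lifts of convex sets and cone factorizations*,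
Math. Oper. Res. 38 (2013) 248–264 = arXiv:1111.3164 [GouveiaParriloThomas2013], §2 "Cone lifts of
convex bodies" (held text `paper:arxiv-1111.3164`, chunks p0005–p0006). This is the theorem behind
§3.1 of H. Fawzi, J. Gouveia, P. A. Parrilo, R. Z. Robinson, R. R. Thomas, *Positive semidefinite
rank*, Math. Program. 153 (2015) = arXiv:1407.4095 [FawziEtAl2015] (held text `paper:arxiv-1407.4095`,
chunk p0009: psd lifts, eq. (3), and Theorem 3.3, the polytope case), whose vocabulary
(`HasPsdLift C k : C = π(S^k_+ ∩ L)`, `PsdLiftSlackMatrix.lean`) is used here.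

[GouveiaParriloThomas2013, §2 p05], verbatim:

> A convex set is called a convex body if it is compact and contains the origin in its interior.
> […] Recall that the polar of a convex set `C ⊂ ℝⁿ` is the set
> `C° = {y ∈ ℝⁿ : ⟨x, y⟩ ≤ 1 ∀ x ∈ C}`. Let `ext(C)` denote the set of extreme points of `C` […]
> Since `C` is compact with the origin in its interior, both `C` and `C°` are convex hulls of their
> respective extreme points. Consider the operator `S : ℝⁿ × ℝⁿ → ℝ` defined by
> `S(x, y) = 1 − ⟨x, y⟩`. We define the slack operator `S_C`, of the convex set `C`, to be the
> restriction of `S` to `ext(C) × ext(C°)`.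
> **Definition 2.1.** Let `K ⊂ ℝᵐ` be a full-dimensional closed convex cone and `C ⊂ ℝⁿ` a
> full-dimensional convex body. A `K`-lift of `C` is a set `Q = K ∩ L`, where `L ⊂ ℝᵐ` is an affine
> subspace, and `π : ℝᵐ → ℝⁿ` is a linear map such that `C = π(Q)`. If `L` intersects the interior
> of `K` we say that `Q` is a proper `K`-lift of `C`.
> **Definition 2.2.** […] We say that the slack operator `S_C` is `K`-factorizable if there exist
> maps (not necessarily linear) `A : ext(C) → K` and `B : ext(C°) → K*` such that
> `S_C(x, y) = ⟨A(x), B(y)⟩` for all `(x, y) ∈ ext(C) × ext(C°)`.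
> **Theorem 2.4.** If `C` has a proper `K`-lift then `S_C` is `K`-factorizable. Conversely, if `S_C`
> is `K`-factorizable then `C` has a `K`-lift.

[GouveiaParriloThomas2013, §2 p06], verbatim:

> **Corollary 2.6.** If `K` is a nice cone, then whenever `C` has a `K`-lift (not necessarily
> proper), `S_C` has a `K`-factorization. […] Polyhedral cones, second order cones and the cones
> of real symmetric psd matrices `S^k_+` are all nice.
> **Proposition 2.8.** If `C₁` and `C₂` are convex bodies, and `K₁` and `K₂` are closed convex
> cones such that `C₁` has a `K₁`-lift and `C₂` has a `K₂`-lift, then the following are true: […]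
> (2) `C₁°` has a `K₁*`-lift; […] The second is an immediate consequence of Theorem 2.4.

## What is proved here (`K = K* = S^k_+`; no named facts; everything from Mathlib and the tree)

The ambient space is any finite-dimensional real inner product space `E` (the paper's `ℝⁿ`); the
polar is the tree's `PolarsOfConvexSets.polarInner C = {y | ∀ x ∈ C, ⟪x, y⟫ ≤ 1}` (Rockafellar
§14), the extreme points are Mathlib's `Set.extremePoints ℝ`, and "`C` has a `S^k_+`-lift" is
`HasPsdLift C k` (FGPRT eq. (3) = GPT Def. 2.1 with `K = S^k_+`, `π` linear).

* `HasPsdLift.exists_psd_factorization_polarInner` — **Theorem 2.4 "⇒" with Corollary 2.6 for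
  `S^k_+`** (no properness): if a BOUNDED set `C` has a psd lift of size `k ≥ 1`, then there are
  `A, B : E → S^k` with `A(x) ⪰ 0` for `x ∈ C`, `B(y) ⪰ 0` for `y ∈ C°`, and
  `Tr(A(x) B(y)) = 1 − ⟪x, y⟫` on ALL of `C × C°` (hence on `ext(C) × ext(C°)`). The printed proof's
  Slater step ("since `w₀` lies in the interior of `K`, by Slater's condition we have strong
  duality") is replaced, as in the tree's polytope case `HasPsdLift.hasPsdFactorization_pairSlackMatrix`
  (FGPRT Thm. 3.3), by the Slater-free facial-reduction certificate
  `exists_posSemidef_certificate_of_le_on_psdLift` (`1 − ⟪π M, y⟫ = Tr(U_y M) + μ_y` on `S^k_+ ∩ L`,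
  `U_y ⪰ 0`, `μ_y ≥ 0`), the constants `μ_y` being absorbed by a psd `E₀` with `Tr(E₀ M) = 1` on the
  lift, built from the certificates of `±⟪·, c⟫`, `c = x₁ − x₂` for two points of `C`
  (boundedness of `C` is what this needs; for unbounded `C` the all-of-`C × C°` form fails, e.g.
  `C = [0, ∞) = π(S^1_+)`, `C° = (−∞, 0]`: `1 + ts = a(t) b(s)` has no solution). A singleton `C`
  is factorized by `A = I_k`, `B(y) = (1 − ⟪x₀, y⟫) I_k / k`.
* `hasPsdLift_of_psd_factorization` — **Theorem 2.4 "⇐"**: for a convex body `C` (compact, convex,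
  `0 ∈ int C`) and maps `A, B` with `A(x) ⪰ 0` on `ext(C)`, `B(y) ⪰ 0` on `ext(C°)` and
  `Tr(A(x)B(y)) = 1 − ⟪x, y⟫` on `ext(C) × ext(C°)`, `C` has a psd lift of size `k`. This is the
  printed construction: `L = {X : 1 − ⟪π X, y⟫ = Tr(X B(y)) ∀ y ∈ ext(C°)}` with the LINEAR reading
  map `π` ("the map that sends `z` to `x_z` … can be extended to a linear map") written out through
  an orthonormal basis `(b_i)` of `E`: since `C°` is a convex body, `ext(C°)` affinely spans `E`,
  so `b_i = Σ_a f_i(a) (y_a − y'_a)` with `y_a, y'_a ∈ ext(C°)` and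
  `π(X) = Σ_i (Σ_a f_i(a) (Tr(X B(y'_a)) − Tr(X B(y_a)))) b_i` satisfies `π(A(x)) = x`;
  `π(S^k_+ ∩ L) ⊆ C°° = C` by the bipolar theorem (tree: `polarInner_polarInner_eq_self`,
  Rockafellar Thm. 14.5) after Krein–Milman for `C°` (Mathlib), and `C = conv(ext C) ⊆ π(S^k_+ ∩ L)`
  by Minkowski's theorem (tree: `convexHull_extremePoints_eq`, BPT Thm. A.12).
* `hasPsdLift_iff_exists_psd_factorization` — **Theorem 2.4 + Corollary 2.6 for `S^k_+`**, the
  equivalence for convex bodies and `k ≥ 1` (for `k = 0` it fails in `E = 0`: `C = {0} = E` is a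
  convex body with a size-`0` lift while `S_C(0, 0) = 1`).
* `HasPsdLift.polar`, `hasPsdLift_polarInner_iff` — **Proposition 2.8 (2)** for `S^k_+ = (S^k_+)*`:
  a convex body has a psd lift of size `k` iff its polar body does.
* Inner-product forms of Rockafellar's Cor. 14.5.1 used on the way (the tree's
  `PolarsOfConvexSets` has them in the dual-space encoding `polar C ⊆ E*`):
  `isClosed_polarInner`, `convex_polarInner`, `ball_subset_polarInner`,
  `zero_mem_interior_polarInner` (`C` bounded ⇒ `0 ∈ int C°`), `isBounded_polarInner`
  (`0 ∈ int C ⇒ C°` bounded), `isCompact_polarInner`.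
* `exists_psd_dualMap_of_psdLift` — the dual map of the printed proof in operator form: for a
  lift `(L, π)` with bounded image containing two points there is ONE map `B : C° → S^k_+` with
  `Tr(M B(y)) = 1 − ⟪π M, y⟫` for EVERY `M ∈ S^k_+ ∩ L` (p05: "Note that for such a `z`,
  `⟨w_i, z⟩ = 1` for all `w_i ∈ L`", whence `⟨w, B(y)⟩ = 1 − ⟨π w, y⟩`); hence
  `exists_psd_factorization_of_section`: ANY section `A` of `π` over `C` (`A(x) ∈ S^k_+ ∩ L`,
  `π(A(x)) = x`) is completed to a factorization — the remark used in the proof of Theorem 2.12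
  (p08: "we can pick as a map from `ext(C) → K` any section of the projection `π`").
* Coordinates `ℝⁿ = Fin n → ℝ` with the dot product, the form used by the tree's psd-rank files
  (`C° = dualBody C = {y | ∀ x ∈ C, x ⬝ᵥ y ≤ 1}` of `CubeOctahedronDuality`, BPT (5.15)):
  `HasPsdLift.exists_psd_factorization_dualBody` (Theorem 2.4 "⇒"/Cor. 2.6 on `C × C°`) and
  `hasPsdLift_iff_exists_psd_factorization_dotProduct` (Theorem 2.4 for convex bodies of `ℝⁿ`),
  transported from `EuclideanSpace ℝ (Fin n)` along `EuclideanSpace.equiv`.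
* `HasPsdLift.closure` — a consequence of Theorem 2.4 and FGPRT Thm. 2.12 (lower semicontinuity
  of psd rank, tree: `FawziEtAl2015_thm212_holds`) through the finite-slack-matrix criterion: the
  closure of a bounded convex set with `0` in its interior and a psd lift of size `k` has a psd lift
  of size `k` (sample the factorization along sequences and pass to the limit).
* `HasPsdLift.image_const_add` — translations keep the psd-lift size of a bounded set with two
  points (`0 ∉ L`, so some linear functional `f` is `≡ 1` on `L` and `X ↦ f(X) v + π X` is a linear
  lift map of `v + C`); hence `HasPsdLift.closure_of_interior_nonempty`, the translation-invariant
  form of `HasPsdLift.closure`.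
* `hasPsdLift_iff_forall_finite_slackMatrix` — Theorem 2.4 combined with the tree's compactness
  theorem for psd rank over arbitrary index sets (`HasPsdFactorization.of_finite`,
  `SmallPsdLiftExtremePoints.lean`, a consequence of Briët–Dadush–Pokutta Thm. 6): a convex body
  has a psd lift of size `k` iff EVERY FINITE slack matrix `[1 − ⟪x_i, y_j⟫]`, `x_i ∈ ext(C)`,
  `y_j ∈ ext(C°)`, has psd rank `≤ k` — the convex-body analogue of FGPRT Thm. 3.3's reading of
  `rank_psd S_{P,Q}` as the least size of a sandwiched psd lift, and the form in which finite
  psd-rank lower bounds (the tree's matrix results) bound lift sizes of convex bodies.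

Special cases already in the tree: the polytope/pair version (FGPRT Thm. 3.3,
`PsdLiftSlackMatrix.lean`), the Euclidean ball (`SmallPsdLiftExtremePoints.lean`,
`hasPsdLift_euclideanBall_iff_exists_psd_factorization`, coordinates `Fin n → ℝ`), and the block-psd
cones `(S^d_+)^r` for polytopes (`BlockPsdLiftFactorization.lean`). NOT here: general closed convex
cones `K` (Definition 2.5 / Pataki's niceness), Theorem 2.9 (projective transformations),
Definitions 2.10–2.11 (symmetric lifts).
-/

noncomputable section

open Matrix Set Metric
open scoped MatrixOrder RealInnerProductSpace

namespace Literature.Combinatorics.Optimization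

open Literature.Analysis.Convex.PolarsOfConvexSets (polarInner mem_polarInner_iff
  polarInner_polarInner_eq_self)
open Literature.Analysis.Convex.CompactConvexExtremePoints (convexHull_extremePoints_eq)
open Literature.LinearAlgebra.Matrix.NearestPositiveSemidefinite (trace_mul_nonneg)

variable {E : Type*} [NormedAddCommGroup E] [InnerProductSpace ℝ E]
variable {k : ℕ}

/-! ### The polar body in a real inner product space (Rockafellar Cor. 14.5.1, inner-product form) -/

/-- `C°` is closed (an intersection of closed half-spaces).
[cite: Rockafellar1970, §14 Thm 14.5 (p. 125)] -/
theorem isClosed_polarInner (C : Set E) : IsClosed (polarInner C) := by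
  have h : polarInner C = ⋂ x ∈ C, {y : E | ⟪x, y⟫ ≤ 1} := by
    ext y
    simp only [mem_polarInner_iff, mem_iInter, mem_setOf_eq]
  rw [h]
  exact isClosed_biInter fun x _ =>
    isClosed_le (continuous_const.inner continuous_id) continuous_const

/-- `C°` is convex. [cite: Rockafellar1970, §14 Thm 14.5 (p. 125)] -/
theorem convex_polarInner (C : Set E) : Convex ℝ (polarInner C) := by
  intro y hy z hz a b ha hb hab x hx
  have h₁ := hy x hx
  have h₂ := hz x hx
  rw [inner_add_right, real_inner_smul_right, real_inner_smul_right]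
  nlinarith

/-- If `‖x‖ ≤ r` on `C` (`r > 0`) then the open ball of radius `r⁻¹` lies in `C°`.
[cite: Rockafellar1970, §14 Cor 14.5.1 (p. 125)] -/
theorem ball_subset_polarInner {C : Set E} {r : ℝ} (hr : 0 < r) (hC : ∀ x ∈ C, ‖x‖ ≤ r) :
    ball (0 : E) r⁻¹ ⊆ polarInner C := by
  intro y hy x hx
  rw [mem_ball_zero_iff] at hy
  have hx' := hC x hx
  calc ⟪x, y⟫ ≤ ‖x‖ * ‖y‖ := real_inner_le_norm x y
    _ ≤ r * r⁻¹ := mul_le_mul hx' hy.le (norm_nonneg _) hr.le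
    _ = 1 := mul_inv_cancel₀ hr.ne'

/-- **Cor. 14.5.1, dual part, in `ℝⁿ`:** if `C` is bounded then `0 ∈ int C°`.
[cite: Rockafellar1970, §14 Cor 14.5.1 (p. 125)] -/
theorem zero_mem_interior_polarInner {C : Set E} (hC : Bornology.IsBounded C) :
    (0 : E) ∈ interior (polarInner C) := by
  obtain ⟨R, hR⟩ := hC.exists_norm_le
  set R' : ℝ := max R 1 with hR'
  have hR'0 : 0 < R' := lt_of_lt_of_le one_pos (le_max_right _ _)
  exact interior_maximal
    (ball_subset_polarInner hR'0 fun x hx => (hR x hx).trans (le_max_left _ _)) isOpen_ball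
    (mem_ball_self (inv_pos.mpr hR'0))

/-- **Cor. 14.5.1 in `ℝⁿ`:** if `0 ∈ int C` then `C°` is bounded (by `2/ε` when `B(0, ε) ⊆ C`).
[cite: Rockafellar1970, §14 Cor 14.5.1 (p. 125)] -/
theorem isBounded_polarInner {C : Set E} (h : (0 : E) ∈ interior C) :
    Bornology.IsBounded (polarInner C) := by
  obtain ⟨ε, hε, hball⟩ := Metric.mem_nhds_iff.mp (mem_interior_iff_mem_nhds.mp h)
  refine (isBounded_closedBall (x := (0 : E)) (r := 2 / ε)).subset fun y hy => ?_
  rw [mem_closedBall_zero_iff]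
  rcases eq_or_ne y 0 with rfl | hy0
  · rw [norm_zero]; positivity
  have hny : 0 < ‖y‖ := norm_pos_iff.mpr hy0
  set z : E := (ε / 2 / ‖y‖) • y with hz
  have hzn : ‖z‖ = ε / 2 := by
    rw [hz, norm_smul, Real.norm_eq_abs, abs_of_pos (by positivity), div_mul_cancel₀ _ hny.ne']
  have hzC : z ∈ C := hball (by rw [mem_ball_zero_iff, hzn]; linarith)
  have h₁ : ⟪z, y⟫ ≤ 1 := hy z hzC
  have h₂ : ⟪z, y⟫ = ε / 2 / ‖y‖ * ‖y‖ ^ 2 := by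
    rw [hz, real_inner_smul_left, real_inner_self_eq_norm_sq]
  have h₃ : ε / 2 / ‖y‖ * ‖y‖ ^ 2 = ε / 2 * ‖y‖ := by
    field_simp
  rw [h₂, h₃] at h₁
  rw [le_div_iff₀ hε]
  linarith

/-- The polar of a set with `0` in its interior is compact (finite dimension).
[cite: Rockafellar1970, §14 Cor 14.5.1 (p. 125)] -/
theorem isCompact_polarInner [FiniteDimensional ℝ E] {C : Set E} (h : (0 : E) ∈ interior C) :
    IsCompact (polarInner C) :=
  Metric.isCompact_of_isClosed_isBounded (isClosed_polarInner C) (isBounded_polarInner h)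

/-! ### Theorem 2.4 "⇒" (with Corollary 2.6): a psd lift of a bounded set factorizes `1 − ⟪x, y⟫` -/

/-- A psd "unit" on a lift with two distinct image points: if `π(S^k_+ ∩ L)` is bounded and
contains `π M₁ ≠ π M₂`, there is `E₀ ⪰ 0` with `Tr(E₀ M) = 1` for every `M ⪰ 0` in `L`. From the
facial-reduction certificates of the two bounded functionals `±⟪π(·), c⟫`, `c = π M₁ − π M₂`:
their psd parts sum to a functional that is a constant `w` on the lift, and `w > 0` since
otherwise `⟪π M, c⟫` would be constant on the lift. (The device of the tree's proof of FGPRT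
Thm. 3.3, with LP multipliers replaced by boundedness.)
[cite: FawziEtAl2015, Thm. 3.3 proof (p10)] -/
private theorem exists_posSemidef_trace_eq_one (L : AffineSubspace ℝ (Matrix (Fin k) (Fin k) ℝ))
    (π : Matrix (Fin k) (Fin k) ℝ →ₗ[ℝ] E)
    (hbdd : Bornology.IsBounded (π '' {M | M.PosSemidef ∧ M ∈ L}))
    {M₁ M₂ : Matrix (Fin k) (Fin k) ℝ} (hM₁ : M₁.PosSemidef ∧ M₁ ∈ L)
    (hM₂ : M₂.PosSemidef ∧ M₂ ∈ L) (hne : π M₁ ≠ π M₂) :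
    ∃ E₀ : Matrix (Fin k) (Fin k) ℝ, E₀.PosSemidef ∧
      ∀ M : Matrix (Fin k) (Fin k) ℝ, M.PosSemidef → M ∈ L → (E₀ * M).trace = 1 := by
  obtain ⟨R, hR⟩ := hbdd.exists_norm_le
  set c : E := π M₁ - π M₂ with hc
  have hc0 : c ≠ 0 := sub_ne_zero.mpr hne
  -- the functional `M ↦ ⟪π M, c⟫`
  let g : Matrix (Fin k) (Fin k) ℝ →ₗ[ℝ] ℝ :=
    { toFun := fun M => ⟪π M, c⟫
      map_add' := fun M N => by rw [map_add, inner_add_left]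
      map_smul' := fun a M => by
        rw [map_smul, real_inner_smul_left, RingHom.id_apply, smul_eq_mul] }
  have hg : ∀ M, g M = ⟪π M, c⟫ := fun M => rfl
  have hbound : ∀ M : Matrix (Fin k) (Fin k) ℝ, M.PosSemidef → M ∈ L →
      |⟪π M, c⟫| ≤ R * ‖c‖ := by
    intro M hM hML
    calc |⟪π M, c⟫| ≤ ‖π M‖ * ‖c‖ := abs_real_inner_le_norm _ _
      _ ≤ R * ‖c‖ :=
        mul_le_mul_of_nonneg_right (hR _ ⟨M, ⟨hM, hML⟩, rfl⟩) (norm_nonneg _)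
  obtain ⟨Up, hUp, μp, hμp, hp⟩ :=
    exists_posSemidef_certificate_of_le_on_psdLift L g (R * ‖c‖) ⟨M₁, hM₁⟩
      fun M hM hML => by
        rw [hg]
        exact (le_abs_self _).trans (hbound M hM hML)
  obtain ⟨Um, hUm, μm, hμm, hm⟩ :=
    exists_posSemidef_certificate_of_le_on_psdLift L (-g) (R * ‖c‖) ⟨M₁, hM₁⟩
      fun M hM hML => by
        rw [LinearMap.neg_apply, hg]
        exact (neg_le_abs _).trans (hbound M hM hML)
  set w : ℝ := 2 * (R * ‖c‖) - μp - μm with hw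
  have hsum : ∀ M : Matrix (Fin k) (Fin k) ℝ, M.PosSemidef → M ∈ L →
      (Up * M).trace + (Um * M).trace = w := by
    intro M hM hML
    have h₁ := hp M hM hML
    have h₂ := hm M hM hML
    rw [LinearMap.neg_apply, hg] at h₂
    rw [hg] at h₁
    rw [hw]
    linarith
  have hwpos : 0 < w := by
    by_contra hle
    push Not at hle
    have hzero : ∀ M : Matrix (Fin k) (Fin k) ℝ, M.PosSemidef → M ∈ L →
        (Up * M).trace = 0 := by
      intro M hM hML
      have h₁ : 0 ≤ (Up * M).trace := trace_mul_nonneg hUp hM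
      have h₂ : 0 ≤ (Um * M).trace := trace_mul_nonneg hUm hM
      have h₃ := hsum M hM hML
      linarith
    have hconst : ∀ M : Matrix (Fin k) (Fin k) ℝ, M.PosSemidef → M ∈ L →
        ⟪π M, c⟫ = R * ‖c‖ - μp := by
      intro M hM hML
      have h₁ := hp M hM hML
      rw [hg, hzero M hM hML] at h₁
      linarith
    have h12 : ⟪π M₁ - π M₂, c⟫ = 0 := by
      rw [inner_sub_left, hconst M₁ hM₁.1 hM₁.2, hconst M₂ hM₂.1 hM₂.2, sub_self]
    exact hc0 (inner_self_eq_zero.mp h12)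
  refine ⟨w⁻¹ • (Up + Um), (hUp.add hUm).smul (inv_nonneg.mpr hwpos.le), fun M hM hML => ?_⟩
  rw [Matrix.smul_mul, trace_smul, smul_eq_mul, Matrix.add_mul, trace_add, hsum M hM hML,
    inv_mul_cancel₀ hwpos.ne']

/-- **The dual map of GPT's proof of Theorem 2.4 "⇒", in operator form, for `K = S^k_+` and
without properness.** Let `(L, π)` be a psd lift datum whose image `C = π(S^k_+ ∩ L)` is bounded
and has two points. Then there is ONE map `B : E → S^k` with `B(y) ⪰ 0` for `y ∈ C°` and
`Tr(M B(y)) = 1 − ⟪π M, y⟫` for every `y ∈ C°` and EVERY `M ⪰ 0` in `L` — the printed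
`B(y) = z − π*(y)` with "`⟨w_i, z⟩ = 1` for all `w_i ∈ L`" (p05), so that
`⟨w, B(y)⟩ = 1 − ⟨π w, y⟩` on the lift; in particular `B` does not depend on the choice of
preimages `A(x)`. Formalised with the Slater-free certificate
`exists_posSemidef_certificate_of_le_on_psdLift` (`1 − ⟪π M, y⟫ = Tr(U_y M) + μ_y` on the lift)
and `B(y) = U_y + μ_y E₀`, `Tr(E₀ M) = 1` on the lift (`exists_posSemidef_trace_eq_one`).
[cite: GouveiaParriloThomas2013, Thm. 2.4 proof (§2, p05)]
[cite: FawziEtAl2015, Thm. 3.3 proof (p10)] -/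
theorem exists_psd_dualMap_of_psdLift (L : AffineSubspace ℝ (Matrix (Fin k) (Fin k) ℝ))
    (π : Matrix (Fin k) (Fin k) ℝ →ₗ[ℝ] E)
    (hbdd : Bornology.IsBounded (π '' {M | M.PosSemidef ∧ M ∈ L}))
    (hnt : (π '' {M | M.PosSemidef ∧ M ∈ L}).Nontrivial) :
    ∃ B : E → Matrix (Fin k) (Fin k) ℝ,
      (∀ y ∈ polarInner (π '' {M | M.PosSemidef ∧ M ∈ L}), (B y).PosSemidef) ∧
      ∀ y ∈ polarInner (π '' {M | M.PosSemidef ∧ M ∈ L}), ∀ M : Matrix (Fin k) (Fin k) ℝ,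
        M.PosSemidef → M ∈ L → (M * B y).trace = 1 - ⟪π M, y⟫ := by
  classical
  set lift : Set (Matrix (Fin k) (Fin k) ℝ) := {M | M.PosSemidef ∧ M ∈ L} with hlift
  obtain ⟨_, ⟨M₁, hM₁, rfl⟩, _, ⟨M₂, hM₂, rfl⟩, hne⟩ := hnt
  obtain ⟨E₀, hE₀, hE₀1⟩ := exists_posSemidef_trace_eq_one L π hbdd hM₁ hM₂ hne
  -- conic-duality certificates for `y ∈ C°`
  have hcert : ∀ y : E, ∃ (U : Matrix (Fin k) (Fin k) ℝ) (μ : ℝ), y ∈ polarInner (π '' lift) →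
      U.PosSemidef ∧ 0 ≤ μ ∧ ∀ M : Matrix (Fin k) (Fin k) ℝ, M.PosSemidef → M ∈ L →
        1 - ⟪π M, y⟫ = (U * M).trace + μ := by
    intro y
    by_cases hy : y ∈ polarInner (π '' lift)
    · let g : Matrix (Fin k) (Fin k) ℝ →ₗ[ℝ] ℝ :=
        { toFun := fun M => ⟪π M, y⟫
          map_add' := fun M N => by rw [map_add, inner_add_left]
          map_smul' := fun a M => by
            rw [map_smul, real_inner_smul_left, RingHom.id_apply, smul_eq_mul] }
      have hg : ∀ M, g M = ⟪π M, y⟫ := fun M => rfl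
      obtain ⟨U, hU, μ, hμ, h⟩ :=
        exists_posSemidef_certificate_of_le_on_psdLift L g 1 ⟨M₁, hM₁⟩ fun M hM hML => by
          rw [hg]
          exact hy (π M) ⟨M, ⟨hM, hML⟩, rfl⟩
      exact ⟨U, μ, fun _ => ⟨hU, hμ, fun M hM hML => by rw [← hg]; exact h M hM hML⟩⟩
    · exact ⟨0, 0, fun h => absurd h hy⟩
  choose U μ hUμ using hcert
  refine ⟨fun y => U y + μ y • E₀, fun y hy => (hUμ y hy).1.add (hE₀.smul (hUμ y hy).2.1),
    fun y hy M hM hML => ?_⟩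
  have h := (hUμ y hy).2.2 M hM hML
  rw [Matrix.mul_add, trace_add, Matrix.mul_smul, trace_smul, smul_eq_mul,
    trace_mul_comm M (U y), trace_mul_comm M E₀, hE₀1 M hM hML, mul_one]
  linarith

/-- **"Any section of `π` can be taken as the map `A`"** (the remark in the proof of GPT
Theorem 2.12, p08: "it is actually constructive, in the sense that we can pick as a map from
`ext(C) → K` any section of the projection `π`"), for `K = S^k_+`: if `C = π(S^k_+ ∩ L)` is
bounded with two points and `A(x) ∈ S^k_+ ∩ L`, `π(A(x)) = x` for `x ∈ C`, then some
`B : C° → S^k_+` completes `A` to a factorization `Tr(A(x) B(y)) = 1 − ⟪x, y⟫` on `C × C°`.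
[cite: GouveiaParriloThomas2013, Thm. 2.12 proof (§2, p08) and Thm. 2.4 proof (p05)] -/
theorem exists_psd_factorization_of_section (L : AffineSubspace ℝ (Matrix (Fin k) (Fin k) ℝ))
    (π : Matrix (Fin k) (Fin k) ℝ →ₗ[ℝ] E)
    (hbdd : Bornology.IsBounded (π '' {M | M.PosSemidef ∧ M ∈ L}))
    (hnt : (π '' {M | M.PosSemidef ∧ M ∈ L}).Nontrivial) {A : E → Matrix (Fin k) (Fin k) ℝ}
    (hA : ∀ x ∈ π '' {M | M.PosSemidef ∧ M ∈ L}, (A x).PosSemidef ∧ A x ∈ L ∧ π (A x) = x) :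
    ∃ B : E → Matrix (Fin k) (Fin k) ℝ,
      (∀ y ∈ polarInner (π '' {M | M.PosSemidef ∧ M ∈ L}), (B y).PosSemidef) ∧
      ∀ x ∈ π '' {M | M.PosSemidef ∧ M ∈ L}, ∀ y ∈ polarInner (π '' {M | M.PosSemidef ∧ M ∈ L}),
        (A x * B y).trace = 1 - ⟪x, y⟫ := by
  obtain ⟨B, hB, hBtr⟩ := exists_psd_dualMap_of_psdLift L π hbdd hnt
  refine ⟨B, hB, fun x hx y hy => ?_⟩
  obtain ⟨hAx, hAxL, hπA⟩ := hA x hx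
  rw [hBtr y hy (A x) hAx hAxL, hπA]

/-- **GPT Theorem 2.4, direction "lift ⇒ factorization", with Corollary 2.6 for the nice cone
`K = S^k_+` (no properness of the lift needed).** If a bounded set `C ⊆ E` has a psd lift
`C = π(S^k_+ ∩ L)` of size `k ≥ 1`, then there are maps `A, B : E → S^k` with `A(x) ⪰ 0` for
`x ∈ C`, `B(y) ⪰ 0` for `y ∈ C° = {y | ⟪x, y⟫ ≤ 1 ∀ x ∈ C}`, and
`Tr(A(x) B(y)) = 1 − ⟪x, y⟫` for all `(x, y) ∈ C × C°` — in particular a `S^k_+`-factorization of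
the slack operator `S_C` on `ext(C) × ext(C°)` (Def. 2.2). Printed proof: `A(x)` = any point of
`π⁻¹(x) ∩ S^k_+ ∩ L`; `B(y) = z − π*(y) ∈ K*` from strong duality for `max ⟨y, x⟩, x ∈ C` (`= 1`
at extreme `y`). Formalised for every `y ∈ C°` with the Slater-free certificate
`exists_posSemidef_certificate_of_le_on_psdLift` (`1 − ⟪π M, y⟫ = Tr(U_y M) + μ_y` on the lift)
and `B(y) = U_y + μ_y E₀`, `Tr(E₀ M) = 1` on the lift (`exists_posSemidef_trace_eq_one`); a
singleton `C = {x₀}` by `A = I_k`, `B(y) = (1 − ⟪x₀, y⟫) I_k / k`. Boundedness replaces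
"convex body"; it cannot be dropped in this all-of-`C × C°` form (module docstring).
[cite: GouveiaParriloThomas2013, Thm. 2.4 and Cor. 2.6 (§2, p05–p06)]
[cite: FawziEtAl2015, §3.1 eq. (3) and Thm. 3.3 (p09–p10)] -/
theorem HasPsdLift.exists_psd_factorization_polarInner {C : Set E} (hC : HasPsdLift C k)
    (hk : 1 ≤ k) (hbdd : Bornology.IsBounded C) :
    ∃ (A B : E → Matrix (Fin k) (Fin k) ℝ),
      (∀ x ∈ C, (A x).PosSemidef) ∧ (∀ y ∈ polarInner C, (B y).PosSemidef) ∧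
      ∀ x ∈ C, ∀ y ∈ polarInner C, (A x * B y).trace = 1 - ⟪x, y⟫ := by
  classical
  obtain ⟨L, π, rfl⟩ := hC
  set lift : Set (Matrix (Fin k) (Fin k) ℝ) := {M | M.PosSemidef ∧ M ∈ L} with hlift
  have hk0 : (k : ℝ) ≠ 0 := by exact_mod_cast Nat.one_le_iff_ne_zero.mp hk
  by_cases hsub : (π '' lift).Subsingleton
  · rcases (π '' lift).eq_empty_or_nonempty with hempty | ⟨x₀, hx₀⟩
    · refine ⟨fun _ => 1, fun _ => 0, fun x hx => ?_, fun _ _ => PosSemidef.zero,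
        fun x hx => ?_⟩
      · rw [hempty] at hx
        exact absurd hx (notMem_empty x)
      · rw [hempty] at hx
        exact absurd hx (notMem_empty x)
    · refine ⟨fun _ => 1, fun y => ((1 - ⟪x₀, y⟫) / k) • (1 : Matrix (Fin k) (Fin k) ℝ),
        fun _ _ => PosSemidef.one,
        fun y hy => PosSemidef.one.smul (div_nonneg ?_ (Nat.cast_nonneg k)),
        fun x hx y hy => ?_⟩
      · exact sub_nonneg.mpr (hy x₀ hx₀)
      · rw [hsub hx hx₀, Matrix.one_mul, trace_smul, trace_one, Fintype.card_fin, smul_eq_mul]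
        field_simp
  · -- the dual map `B` (independent of the preimages) and preimages `A(x)` of the points of `C`
    obtain ⟨B, hB, hBtr⟩ :=
      exists_psd_dualMap_of_psdLift L π hbdd (Set.not_subsingleton_iff.mp hsub)
    have hpre : ∀ x : E, ∃ M : Matrix (Fin k) (Fin k) ℝ, x ∈ π '' lift →
        (M.PosSemidef ∧ M ∈ L) ∧ π M = x := by
      intro x
      by_cases hx : x ∈ π '' lift
      · obtain ⟨M, hM, hMx⟩ := hx
        exact ⟨M, fun _ => ⟨hM, hMx⟩⟩
      · exact ⟨0, fun h => absurd h hx⟩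
    choose A hA using hpre
    refine ⟨A, B, fun x hx => (hA x hx).1.1, hB, fun x hx y hy => ?_⟩
    obtain ⟨⟨hAx, hAxL⟩, hπA⟩ := hA x hx
    rw [hBtr y hy (A x) hAx hAxL, hπA]

/-! ### Theorem 2.4 "⇐": a psd factorization of the slack operator of a convex body gives a psd lift -/

/-- **The linear reading map of GPT's proof** ("the map that sends `z` to `x_z` is … affine. Since
the origin is not in `L_K`, we can extend it to a linear map `π`"), written out: if `S ⊆ E`
affinely spans `E` (`vectorSpan S = E`) and `B : E → S^k` is any map, there is a LINEAR
`π : S^k → E` such that `π X = x` whenever `Tr(X B(y)) = 1 − ⟪x, y⟫` for all `y ∈ S`. With an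
orthonormal basis `b_i = Σ_a f_i(a) (y_a − y'_a)` (`y_a, y'_a ∈ S`),
`π X = Σ_i (Σ_a f_i(a) (Tr(X B y'_a) − Tr(X B y_a))) b_i`.
[cite: GouveiaParriloThomas2013, Thm. 2.4 proof (§2, p06)] -/
private theorem exists_readingMap [FiniteDimensional ℝ E] {S : Set E} (hS : vectorSpan ℝ S = ⊤)
    (B : E → Matrix (Fin k) (Fin k) ℝ) :
    ∃ π : Matrix (Fin k) (Fin k) ℝ →ₗ[ℝ] E, ∀ (X : Matrix (Fin k) (Fin k) ℝ) (x : E),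
      (∀ y ∈ S, (X * B y).trace = 1 - ⟪x, y⟫) → π X = x := by
  classical
  let b := stdOrthonormalBasis ℝ E
  -- each basis vector is a finite linear combination of differences of points of `S`
  have hmem : ∀ i, ∃ (f : E → ℝ) (t : Finset E), (↑t : Set E) ⊆ S -ᵥ S ∧
      ∑ a ∈ t, f a • a = b i := by
    intro i
    have hi : b i ∈ vectorSpan ℝ S := by
      rw [hS]
      exact Submodule.mem_top
    rw [vectorSpan_def] at hi
    obtain ⟨f, t, ht, -, hsum⟩ := Submodule.mem_span_iff_exists_finset_subset.mp hi
    exact ⟨f, t, ht, hsum⟩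
  choose f t ht hft using hmem
  -- a choice of endpoints for every difference
  have hdec : ∀ a : E, ∃ p : E × E, a ∈ S -ᵥ S → p.1 ∈ S ∧ p.2 ∈ S ∧ a = p.1 - p.2 := by
    intro a
    by_cases ha : a ∈ S -ᵥ S
    · obtain ⟨y, hy, y', hy', hyy'⟩ := Set.mem_vsub.mp ha
      exact ⟨(y, y'), fun _ => ⟨hy, hy', by rw [← hyy', vsub_eq_sub]⟩⟩
    · exact ⟨(0, 0), fun h => absurd h ha⟩
  choose p hp using hdec
  -- the trace functionals `X ↦ Tr(X B(y))`
  let τ : E → (Matrix (Fin k) (Fin k) ℝ →ₗ[ℝ] ℝ) := fun y =>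
    { toFun := fun X => (X * B y).trace
      map_add' := fun X Y => by rw [Matrix.add_mul, trace_add]
      map_smul' := fun c X => by rw [Matrix.smul_mul, trace_smul, RingHom.id_apply] }
  have hτ : ∀ y X, τ y X = (X * B y).trace := fun y X => rfl
  let ℓ : Fin (Module.finrank ℝ E) → (Matrix (Fin k) (Fin k) ℝ →ₗ[ℝ] ℝ) := fun i =>
    ∑ a ∈ t i, f i a • (τ (p a).2 - τ (p a).1)
  have hℓ : ∀ i X, ℓ i X = ∑ a ∈ t i, f i a * ((X * B (p a).2).trace - (X * B (p a).1).trace) := by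
    intro i X
    simp only [ℓ, LinearMap.sum_apply, LinearMap.smul_apply, LinearMap.sub_apply, smul_eq_mul, hτ]
  let π : Matrix (Fin k) (Fin k) ℝ →ₗ[ℝ] E := ∑ i, (ℓ i).smulRight (b i)
  have hπ : ∀ X, π X = ∑ i, ℓ i X • b i := by
    intro X
    simp only [π, LinearMap.sum_apply, LinearMap.smulRight_apply]
  refine ⟨π, fun X x hX => ?_⟩
  have hℓx : ∀ i, ℓ i X = ⟪b i, x⟫ := by
    intro i
    rw [hℓ]
    calc ∑ a ∈ t i, f i a * ((X * B (p a).2).trace - (X * B (p a).1).trace)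
        = ∑ a ∈ t i, f i a * ⟪a, x⟫ := by
          refine Finset.sum_congr rfl fun a ha => ?_
          obtain ⟨h₁, h₂, h₃⟩ := hp a (ht i ha)
          have h₄ : ⟪a, x⟫ = ⟪(p a).1, x⟫ - ⟪(p a).2, x⟫ := by
            rw [← inner_sub_left, ← h₃]
          rw [hX _ h₂, hX _ h₁, h₄, real_inner_comm x (p a).1, real_inner_comm x (p a).2]
          ring
      _ = ⟪∑ a ∈ t i, f i a • a, x⟫ := by
          rw [sum_inner]
          simp only [real_inner_smul_left]
      _ = ⟪b i, x⟫ := by rw [hft i]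
  rw [hπ]
  simp only [hℓx]
  exact b.sum_repr' x

/-- **GPT Theorem 2.4, direction "factorization ⇒ lift", for `K = S^k_+`.** Let `C ⊆ E` be a
convex body (compact, convex, `0 ∈ int C`) and let `A, B : E → S^k` satisfy `A(x) ⪰ 0` for
`x ∈ ext(C)`, `B(y) ⪰ 0` for `y ∈ ext(C°)` and `Tr(A(x) B(y)) = 1 − ⟪x, y⟫` for all
`(x, y) ∈ ext(C) × ext(C°)` (a `S^k_+`-factorization of the slack operator `S_C`, Def. 2.2; the
values of `A, B` elsewhere are irrelevant). Then `C = π(S^k_+ ∩ L)` for the printed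
`L = {X : 1 − ⟪π X, y⟫ = Tr(X B(y)) ∀ y ∈ ext(C°)}` and the linear reading map `π` of
`exists_readingMap` (`ext(C°)` affinely spans `E` because `C°` is a convex body — Krein–Milman and
`0 ∈ int C°`): "`⊇`" since `Tr(X B(y)) ≥ 0` gives `⟪π X, y⟫ ≤ 1` on `ext(C°)`, hence on
`C° = cl conv ext(C°)`, hence `π X ∈ C°° = C` (bipolar theorem); "`⊆`" since `x = π(A(x))` for
`x ∈ ext(C)` and `C = conv(ext C)` (Minkowski). PROVED here.
[cite: GouveiaParriloThomas2013, Thm. 2.4 (§2, p05–p06)]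
[cite: FawziEtAl2015, §3.1 eq. (3) and Thm. 3.3 (p09–p10)] -/
theorem hasPsdLift_of_psd_factorization [FiniteDimensional ℝ E] {C : Set E} (hCc : IsCompact C)
    (hCconv : Convex ℝ C) (h0 : (0 : E) ∈ interior C) {A B : E → Matrix (Fin k) (Fin k) ℝ}
    (hA : ∀ x ∈ C.extremePoints ℝ, (A x).PosSemidef)
    (hB : ∀ y ∈ (polarInner C).extremePoints ℝ, (B y).PosSemidef)
    (hAB : ∀ x ∈ C.extremePoints ℝ, ∀ y ∈ (polarInner C).extremePoints ℝ,
      (A x * B y).trace = 1 - ⟪x, y⟫) :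
    HasPsdLift C k := by
  classical
  haveI : CompleteSpace E := FiniteDimensional.complete ℝ E
  set S : Set E := (polarInner C).extremePoints ℝ with hSdef
  -- the polar body `C°`
  have hPc : IsCompact (polarInner C) := isCompact_polarInner h0
  have hPconv : Convex ℝ (polarInner C) := convex_polarInner C
  have hP0 : (0 : E) ∈ interior (polarInner C) := zero_mem_interior_polarInner hCc.isBounded
  have hKM : closure (convexHull ℝ S) = polarInner C :=
    closure_convexHull_extremePoints hPc hPconv
  -- `ext(C°)` affinely spans `E`
  have hS : vectorSpan ℝ S = ⊤ := by
    have hsub : polarInner C ⊆ (affineSpan ℝ S : Set E) := by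
      rw [← hKM]
      exact closure_minimal (convexHull_subset_affineSpan S)
        (AffineSubspace.closed_of_finiteDimensional _)
    have htop : affineSpan ℝ (interior (polarInner C)) = ⊤ :=
      IsOpen.affineSpan_eq_top isOpen_interior ⟨0, hP0⟩
    have hle : affineSpan ℝ (interior (polarInner C)) ≤ affineSpan ℝ S :=
      affineSpan_le.mpr (interior_subset.trans hsub)
    have heq : affineSpan ℝ S = ⊤ := by
      rw [eq_top_iff, ← htop]
      exact hle
    rw [← direction_affineSpan, heq, AffineSubspace.direction_top]
  obtain ⟨π, hπ⟩ := exists_readingMap hS B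
  -- the affine subspace `L`
  let L : AffineSubspace ℝ (Matrix (Fin k) (Fin k) ℝ) :=
    { carrier := {X | ∀ y ∈ S, 1 - ⟪π X, y⟫ = (X * B y).trace}
      smul_vsub_vadd_mem' := by
        intro c X₁ X₂ X₃ h₁ h₂ h₃ y hy
        have e₁ := h₁ y hy
        have e₂ := h₂ y hy
        have e₃ := h₃ y hy
        have f₁ : ⟪π X₁, y⟫ = 1 - (X₁ * B y).trace := by linarith
        have f₂ : ⟪π X₂, y⟫ = 1 - (X₂ * B y).trace := by linarith
        have f₃ : ⟪π X₃, y⟫ = 1 - (X₃ * B y).trace := by linarith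
        rw [vsub_eq_sub, vadd_eq_add, map_add, map_smul, map_sub, inner_add_left,
          real_inner_smul_left, inner_sub_left, Matrix.add_mul, Matrix.smul_mul, Matrix.sub_mul,
          trace_add, trace_smul, trace_sub, smul_eq_mul, f₁, f₂, f₃]
        ring }
  have hLmem : ∀ X, X ∈ L ↔ ∀ y ∈ S, 1 - ⟪π X, y⟫ = (X * B y).trace := fun X => Iff.rfl
  have hπA : ∀ x ∈ C.extremePoints ℝ, π (A x) = x := fun x hx =>
    hπ (A x) x fun y hy => hAB x hx y hy
  have hAL : ∀ x ∈ C.extremePoints ℝ, A x ∈ L := fun x hx =>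
    (hLmem _).mpr fun y hy => by rw [hπA x hx, hAB x hx y hy]
  have hconv : Convex ℝ {M : Matrix (Fin k) (Fin k) ℝ | M.PosSemidef ∧ M ∈ L} := by
    intro M hM N hN a b ha hb hab
    exact ⟨(hM.1.smul ha).add (hN.1.smul hb), L.convex hM.2 hN.2 ha hb hab⟩
  refine ⟨L, π, Subset.antisymm ?_ ?_⟩
  · -- `C = conv(ext C) ⊆ π(S^k_+ ∩ L)` (Minkowski)
    have hext : C.extremePoints ℝ ⊆ π '' {M : Matrix (Fin k) (Fin k) ℝ | M.PosSemidef ∧ M ∈ L} :=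
      fun x hx => ⟨A x, ⟨hA x hx, hAL x hx⟩, hπA x hx⟩
    rw [← convexHull_extremePoints_eq hCc hCconv]
    exact convexHull_min hext (hconv.linear_image π)
  · -- `π(S^k_+ ∩ L) ⊆ C°° = C` (Krein–Milman for `C°`, bipolar theorem)
    rintro _ ⟨X, ⟨hX, hXL⟩, rfl⟩
    have hle : ∀ y ∈ S, ⟪π X, y⟫ ≤ 1 := fun y hy => by
      have h := (hLmem X).mp hXL y hy
      have hnn : 0 ≤ (X * B y).trace := trace_mul_nonneg hX (hB y hy)
      linarith
    have hH : IsClosed {y : E | ⟪π X, y⟫ ≤ 1} :=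
      isClosed_le (continuous_const.inner continuous_id) continuous_const
    have hHc : Convex ℝ {y : E | ⟪π X, y⟫ ≤ 1} := by
      intro y hy z hz a b ha hb hab
      simp only [mem_setOf_eq] at hy hz ⊢
      rw [inner_add_right, real_inner_smul_right, real_inner_smul_right]
      nlinarith
    have hsub : polarInner C ⊆ {y : E | ⟪π X, y⟫ ≤ 1} := by
      rw [← hKM]
      exact closure_minimal (convexHull_min hle hHc) hH
    have hmem : π X ∈ polarInner (polarInner C) := fun y hy => by
      rw [real_inner_comm]
      exact hsub hy
    rwa [polarInner_polarInner_eq_self hCconv hCc.isClosed (interior_subset h0)] at hmem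

/-- **GPT Theorem 2.4 with Corollary 2.6, `K = S^k_+` (a nice, self-dual cone): a convex body
`C` has a psd lift of size `k` if and only if its slack operator `S_C(x, y) = 1 − ⟪x, y⟫` on
`ext(C) × ext(C°)` has a `S^k_+`-factorization** (`k ≥ 1`; for `k = 0` the equivalence fails in
`E = 0`, where `C = {0}` is a convex body with a size-`0` lift and `S_C(0, 0) = 1`). PROVED here
(`HasPsdLift.exists_psd_factorization_polarInner`, `hasPsdLift_of_psd_factorization`).
[cite: GouveiaParriloThomas2013, Thm. 2.4 and Cor. 2.6 (§2, p05–p06)]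
[cite: FawziEtAl2015, §3.1 eq. (3) and Thm. 3.3 (p09–p10)] -/
theorem hasPsdLift_iff_exists_psd_factorization [FiniteDimensional ℝ E] {C : Set E}
    (hCc : IsCompact C) (hCconv : Convex ℝ C) (h0 : (0 : E) ∈ interior C) (hk : 1 ≤ k) :
    HasPsdLift C k ↔ ∃ A B : E → Matrix (Fin k) (Fin k) ℝ,
      (∀ x ∈ C.extremePoints ℝ, (A x).PosSemidef) ∧
      (∀ y ∈ (polarInner C).extremePoints ℝ, (B y).PosSemidef) ∧
      ∀ x ∈ C.extremePoints ℝ, ∀ y ∈ (polarInner C).extremePoints ℝ,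
        (A x * B y).trace = 1 - ⟪x, y⟫ := by
  constructor
  · intro h
    obtain ⟨A, B, hA, hB, hAB⟩ := h.exists_psd_factorization_polarInner hk hCc.isBounded
    exact ⟨A, B, fun x hx => hA x (extremePoints_subset hx),
      fun y hy => hB y (extremePoints_subset hy),
      fun x hx y hy => hAB x (extremePoints_subset hx) y (extremePoints_subset hy)⟩
  · rintro ⟨A, B, hA, hB, hAB⟩
    exact hasPsdLift_of_psd_factorization hCc hCconv h0 hA hB hAB

/-! ### Proposition 2.8 (2): polars of convex bodies with psd lifts have psd lifts of the same size -/

/-- **GPT Proposition 2.8 (2) for `K₁ = S^k_+ = K₁*`** ("`C₁°` has a `K₁*`-lift … an immediate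
consequence of Theorem 2.4"): if a convex body `C` (compact, convex, `0 ∈ int C`) has a psd lift of
size `k ≥ 1`, so does its polar body `C°`. Proof as printed: a factorization `(A, B)` of `S_C` on
`C × C°` (Theorem 2.4 "⇒") is, transposed (`Tr(B(y)A(x)) = 1 − ⟪y, x⟫`), a factorization of
`S_{C°}` on `ext(C°) × ext(C°°)`, `C°° = C` (bipolar), and `C°` is a convex body
(`isCompact_polarInner`, `zero_mem_interior_polarInner`), so Theorem 2.4 "⇐" applies. PROVED here.
[cite: GouveiaParriloThomas2013, Prop. 2.8 (2) (§2, p06)] -/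
theorem HasPsdLift.polar [FiniteDimensional ℝ E] {C : Set E} (hC : HasPsdLift C k) (hk : 1 ≤ k)
    (hCc : IsCompact C) (hCconv : Convex ℝ C) (h0 : (0 : E) ∈ interior C) :
    HasPsdLift (polarInner C) k := by
  haveI : CompleteSpace E := FiniteDimensional.complete ℝ E
  obtain ⟨A, B, hA, hB, hAB⟩ := hC.exists_psd_factorization_polarInner hk hCc.isBounded
  have hPP : polarInner (polarInner C) = C :=
    polarInner_polarInner_eq_self hCconv hCc.isClosed (interior_subset h0)
  refine hasPsdLift_of_psd_factorization (isCompact_polarInner h0) (convex_polarInner C)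
    (zero_mem_interior_polarInner hCc.isBounded) (A := B) (B := A)
    (fun y hy => hB y (extremePoints_subset hy)) (fun x hx => hA x ?_) fun y hy x hx => ?_
  · rw [hPP] at hx
    exact extremePoints_subset hx
  · rw [hPP] at hx
    rw [trace_mul_comm, hAB x (extremePoints_subset hx) y (extremePoints_subset hy),
      real_inner_comm]

/-- **Proposition 2.8 (2) as an equivalence** ("the theory [is] invariant under duality", §2 p07):
a convex body has a psd lift of size `k ≥ 1` iff its polar body has one (`C°° = C`).
[cite: GouveiaParriloThomas2013, Prop. 2.8 (2) (§2, p06) and §2 p07] -/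
theorem hasPsdLift_polarInner_iff [FiniteDimensional ℝ E] {C : Set E} (hCc : IsCompact C)
    (hCconv : Convex ℝ C) (h0 : (0 : E) ∈ interior C) (hk : 1 ≤ k) :
    HasPsdLift (polarInner C) k ↔ HasPsdLift C k := by
  haveI : CompleteSpace E := FiniteDimensional.complete ℝ E
  have hPP : polarInner (polarInner C) = C :=
    polarInner_polarInner_eq_self hCconv hCc.isClosed (interior_subset h0)
  refine ⟨fun h => ?_, fun h => h.polar hk hCc hCconv h0⟩
  have h' := h.polar hk (isCompact_polarInner h0) (convex_polarInner C)
    (zero_mem_interior_polarInner hCc.isBounded)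
  rwa [hPP] at h'

/-! ### Coordinates `ℝⁿ = Fin n → ℝ` with the dot product -/

section Coordinates

open Literature.Analysis.Convex.CubeOctahedronDuality (dualBody mem_dualBody_iff)

variable {n : ℕ}

/-- The dual body `C° = {ℓ | ∀ x ∈ C, Σ ℓ_i x_i ≤ 1}` of `CubeOctahedronDuality` (BPT (5.15)) is
the dot-product polar `{y | ∀ x ∈ C, x ⬝ᵥ y ≤ 1}` of GPT §2.
[cite: GouveiaParriloThomas2013, §2 (p05)] -/
theorem mem_dualBody_iff_dotProduct {C : Set (Fin n → ℝ)} {y : Fin n → ℝ} :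
    y ∈ dualBody C ↔ ∀ x ∈ C, x ⬝ᵥ y ≤ 1 := by
  rw [mem_dualBody_iff]
  refine forall₂_congr fun x _ => ?_
  rw [dotProduct_comm]
  rfl

/-- Sets with a psd lift are mapped to sets with a psd lift of the same size by linear
equivalences (both directions of `HasPsdLift.image`). [cite: FawziEtAl2015, §3.1 eq. (3) (p09)] -/
theorem hasPsdLift_image_linearEquiv_iff {V W : Type*} [AddCommGroup V] [Module ℝ V]
    [AddCommGroup W] [Module ℝ W] (e : V ≃ₗ[ℝ] W) {C : Set V} :
    HasPsdLift (e '' C) k ↔ HasPsdLift C k := by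
  constructor
  · rintro ⟨L, π, h⟩
    refine ⟨L, e.symm.toLinearMap.comp π, ?_⟩
    have hset : ⇑e.symm '' (⇑e '' C) = C := by
      rw [Set.image_image]
      simp only [LinearEquiv.symm_apply_apply, Set.image_id']
    rw [← hset, h, Set.image_image]
    rfl
  · rintro ⟨L, π, rfl⟩
    refine ⟨L, e.toLinearMap.comp π, ?_⟩
    rw [Set.image_image]
    rfl

/-- `⟪x, y⟫ = x ⬝ᵥ y` under the identification `T = (EuclideanSpace.equiv (Fin n) ℝ).symm`
(`toLp 2`) of `ℝⁿ` with `EuclideanSpace ℝ (Fin n)`. [folklore] -/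
private theorem inner_toEuc (x y : Fin n → ℝ) :
    ⟪(EuclideanSpace.equiv (Fin n) ℝ).symm x, (EuclideanSpace.equiv (Fin n) ℝ).symm y⟫ =
      x ⬝ᵥ y := by
  show ⟪WithLp.toLp 2 x, WithLp.toLp 2 y⟫ = x ⬝ᵥ y
  rw [EuclideanSpace.inner_toLp_toLp, star_trivial, dotProduct_comm]

/-- The polar transported: `(T C)° = T(C°)` for the identification `T`. [folklore] -/
private theorem polarInner_image_toEuc (C : Set (Fin n → ℝ)) :
    polarInner ((EuclideanSpace.equiv (Fin n) ℝ).symm '' C) =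
      (EuclideanSpace.equiv (Fin n) ℝ).symm '' dualBody C := by
  set T := (EuclideanSpace.equiv (Fin n) ℝ).symm with hT
  ext w
  constructor
  · intro hw
    refine ⟨T.symm w, ?_, T.apply_symm_apply w⟩
    rw [mem_dualBody_iff_dotProduct]
    intro x hx
    have h := hw (T x) ⟨x, hx, rfl⟩
    rwa [← T.apply_symm_apply w, hT, inner_toEuc] at h
  · rintro ⟨y, hy, rfl⟩ _ ⟨x, hx, rfl⟩
    rw [hT, inner_toEuc]
    exact (mem_dualBody_iff_dotProduct.mp hy) x hx

/-- Extreme points transported. [folklore] -/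
private theorem extremePoints_image_toEuc (C : Set (Fin n → ℝ)) :
    ((EuclideanSpace.equiv (Fin n) ℝ).symm '' C).extremePoints ℝ =
      (EuclideanSpace.equiv (Fin n) ℝ).symm '' C.extremePoints ℝ := by
  have h := image_extremePoints (𝕜 := ℝ) (EuclideanSpace.equiv (Fin n) ℝ).symm.toLinearEquiv C
  simpa using h.symm

/-- **GPT Theorem 2.4 "⇒" / Corollary 2.6 in coordinates `ℝⁿ = Fin n → ℝ`:** if a bounded
`C ⊆ ℝⁿ` has a psd lift of size `k ≥ 1`, there are `A, B : ℝⁿ → S^k` with `A(x) ⪰ 0` on `C`,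
`B(y) ⪰ 0` on `C° = {y | x ⬝ᵥ y ≤ 1 ∀ x ∈ C}` and `Tr(A(x) B(y)) = 1 − x ⬝ᵥ y` on `C × C°`
(transport of `HasPsdLift.exists_psd_factorization_polarInner` along `EuclideanSpace.equiv`).
[cite: GouveiaParriloThomas2013, Thm. 2.4 and Cor. 2.6 (§2, p05–p06)]
[cite: FawziEtAl2015, §3.1 eq. (3) and Thm. 3.3 (p09–p10)] -/
theorem HasPsdLift.exists_psd_factorization_dualBody {C : Set (Fin n → ℝ)} (hC : HasPsdLift C k)
    (hk : 1 ≤ k) (hbdd : Bornology.IsBounded C) :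
    ∃ (A B : (Fin n → ℝ) → Matrix (Fin k) (Fin k) ℝ),
      (∀ x ∈ C, (A x).PosSemidef) ∧ (∀ y ∈ dualBody C, (B y).PosSemidef) ∧
      ∀ x ∈ C, ∀ y ∈ dualBody C, (A x * B y).trace = 1 - x ⬝ᵥ y := by
  set T := (EuclideanSpace.equiv (Fin n) ℝ).symm with hT
  have hC' : HasPsdLift (T '' C) k := by
    have h := (hasPsdLift_image_linearEquiv_iff T.toLinearEquiv (C := C)).mpr hC
    simpa using h
  have hbdd' : Bornology.IsBounded (T '' C) :=
    (T : (Fin n → ℝ) →L[ℝ] EuclideanSpace ℝ (Fin n)).lipschitz.isBounded_image hbdd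
  obtain ⟨A', B', hA', hB', hAB'⟩ := hC'.exists_psd_factorization_polarInner hk hbdd'
  have hpol : polarInner (T '' C) = T '' dualBody C := polarInner_image_toEuc C
  refine ⟨fun x => A' (T x), fun y => B' (T y), fun x hx => hA' _ ⟨x, hx, rfl⟩,
    fun y hy => hB' _ (by rw [hpol]; exact ⟨y, hy, rfl⟩), fun x hx y hy => ?_⟩
  rw [hAB' _ ⟨x, hx, rfl⟩ _ (by rw [hpol]; exact ⟨y, hy, rfl⟩), hT, inner_toEuc]

/-- **GPT Theorem 2.4 with Corollary 2.6 (`K = S^k_+`) for convex bodies of `ℝⁿ = Fin n → ℝ`,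
dot-product form:** a compact convex `C ⊆ ℝⁿ` with `0 ∈ int C` has a psd lift of size `k ≥ 1`
iff there are `A, B` with `A(x) ⪰ 0` on `ext(C)`, `B(y) ⪰ 0` on `ext(C°)`
(`C° = dualBody C = {y | x ⬝ᵥ y ≤ 1 ∀ x ∈ C}`) and `Tr(A(x) B(y)) = 1 − x ⬝ᵥ y` on
`ext(C) × ext(C°)` (transport of `hasPsdLift_iff_exists_psd_factorization`).
[cite: GouveiaParriloThomas2013, Thm. 2.4 and Cor. 2.6 (§2, p05–p06)]
[cite: FawziEtAl2015, §3.1 eq. (3) and Thm. 3.3 (p09–p10)] -/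
theorem hasPsdLift_iff_exists_psd_factorization_dotProduct {C : Set (Fin n → ℝ)}
    (hCc : IsCompact C) (hCconv : Convex ℝ C) (h0 : (0 : Fin n → ℝ) ∈ interior C) (hk : 1 ≤ k) :
    HasPsdLift C k ↔ ∃ A B : (Fin n → ℝ) → Matrix (Fin k) (Fin k) ℝ,
      (∀ x ∈ C.extremePoints ℝ, (A x).PosSemidef) ∧
      (∀ y ∈ (dualBody C).extremePoints ℝ, (B y).PosSemidef) ∧
      ∀ x ∈ C.extremePoints ℝ, ∀ y ∈ (dualBody C).extremePoints ℝ,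
        (A x * B y).trace = 1 - x ⬝ᵥ y := by
  -- the transported convex body
  set T := (EuclideanSpace.equiv (Fin n) ℝ).symm with hT
  have hlift : HasPsdLift (T '' C) k ↔ HasPsdLift C k := by
    have h := hasPsdLift_image_linearEquiv_iff (k := k) T.toLinearEquiv (C := C)
    simpa using h
  have hCc' : IsCompact (T '' C) := hCc.image T.continuous
  have hCconv' : Convex ℝ (T '' C) := by
    rintro _ ⟨x, hx, rfl⟩ _ ⟨y, hy, rfl⟩ a b ha hb hab
    exact ⟨a • x + b • y, hCconv hx hy ha hb hab, by rw [map_add, map_smul, map_smul]⟩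
  have h0' : (0 : EuclideanSpace ℝ (Fin n)) ∈ interior (T '' C) := by
    have h1 : T 0 ∈ (T : (Fin n → ℝ) → EuclideanSpace ℝ (Fin n)) '' interior C := ⟨0, h0, rfl⟩
    have h2 : (T : (Fin n → ℝ) → EuclideanSpace ℝ (Fin n)) '' interior C = interior (T '' C) := by
      simpa using T.toHomeomorph.image_interior C
    rwa [map_zero, h2] at h1
  have hpol : polarInner (T '' C) = T '' dualBody C := polarInner_image_toEuc C
  have hext : (T '' C).extremePoints ℝ = T '' C.extremePoints ℝ := extremePoints_image_toEuc C
  have hextp : (polarInner (T '' C)).extremePoints ℝ = T '' (dualBody C).extremePoints ℝ := by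
    rw [hpol]
    exact extremePoints_image_toEuc (dualBody C)
  rw [← hlift, hasPsdLift_iff_exists_psd_factorization hCc' hCconv' h0' hk]
  constructor
  · rintro ⟨A', B', hA', hB', hAB'⟩
    refine ⟨fun x => A' (T x), fun y => B' (T y), fun x hx => hA' _ ?_, fun y hy => hB' _ ?_,
      fun x hx y hy => ?_⟩
    · rw [hext]; exact ⟨x, hx, rfl⟩
    · rw [hextp]; exact ⟨y, hy, rfl⟩
    · rw [hAB' _ (by rw [hext]; exact ⟨x, hx, rfl⟩) _ (by rw [hextp]; exact ⟨y, hy, rfl⟩),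
        inner_toEuc]
  · rintro ⟨A, B, hA, hB, hAB⟩
    refine ⟨fun w => A (T.symm w), fun w => B (T.symm w), fun w hw => ?_, fun w hw => ?_,
      fun w hw w' hw' => ?_⟩
    · rw [hext] at hw
      obtain ⟨x, hx, rfl⟩ := hw
      dsimp only
      rw [T.symm_apply_apply]
      exact hA x hx
    · rw [hextp] at hw
      obtain ⟨y, hy, rfl⟩ := hw
      dsimp only
      rw [T.symm_apply_apply]
      exact hB y hy
    · rw [hext] at hw
      rw [hextp] at hw'
      obtain ⟨x, hx, rfl⟩ := hw
      obtain ⟨y, hy, rfl⟩ := hw'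
      dsimp only
      rw [T.symm_apply_apply, T.symm_apply_apply, hAB x hx y hy, inner_toEuc]

end Coordinates

/-! ### The psd-lift size of a convex body is decided by its finite slack matrices -/

section FiniteSlackMatrices

/-- Slack entries are bounded: `1 − ⟪x, y⟫ ≤ 1 + R R'` when `‖x‖ ≤ R` on `C` (`R ≥ 0`) and
`‖y‖ ≤ R'` on `C°`. [folklore] -/
private theorem one_sub_inner_le_of_norm_le {C : Set E} {R R' : ℝ} (hR : ∀ x ∈ C, ‖x‖ ≤ R)
    (hR' : ∀ y ∈ polarInner C, ‖y‖ ≤ R') (hR0 : 0 ≤ R) {x y : E} (hx : x ∈ C)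
    (hy : y ∈ polarInner C) : 1 - ⟪x, y⟫ ≤ 1 + R * R' := by
  have h := abs_real_inner_le_norm x y
  have h₁ : ‖x‖ * ‖y‖ ≤ R * R' := mul_le_mul (hR x hx) (hR' y hy) (norm_nonneg _) hR0
  have h₂ : -(‖x‖ * ‖y‖) ≤ ⟪x, y⟫ := (abs_le.mp h).1
  linarith

/-- **The size of the smallest psd lift of a convex body is determined by its finite slack
matrices.** For a convex body `C` (compact, convex, `0 ∈ int C`) and `k ≥ 1`: `C` has a psd lift
of size `k` iff for all finite families `x_1, …, x_v ∈ ext(C)` and `y_1, …, y_f ∈ ext(C°)` the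
`v × f` matrix `[1 − ⟪x_i, y_j⟫]` (a finite submatrix of the slack operator `S_C`, i.e. a
generalized slack matrix of an inscribed/circumscribed polytope pair in the sense of FGPRT
Def. 3.1) has a psd factorization of size `k`. "⇒" is Theorem 2.4 "⇒" restricted to the samples;
"⇐" is Theorem 2.4 "⇐" applied to a factorization of the whole (bounded) slack operator on
`ext(C) × ext(C°)` obtained from the finite ones by the compactness theorem
`HasPsdFactorization.of_finite` (normal form of Briët–Dadush–Pokutta Thm. 6 + Tychonoff). Hence a
single finite configuration of psd rank `> k` excludes psd lifts of size `k` (as for the sphere in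
`SmallPsdLiftExtremePoints.lean`), and conversely. PROVED here.
[cite: GouveiaParriloThomas2013, Thm. 2.4 and Cor. 2.6 (§2, p05–p06)]
[cite: FawziEtAl2015, Def. 3.1 and Thm. 3.3 (p09–p10)]
[cite: BrietDadushPokutta2014, Thm. 6 (§3, p. 7)] -/
theorem hasPsdLift_iff_forall_finite_slackMatrix [FiniteDimensional ℝ E] {C : Set E}
    (hCc : IsCompact C) (hCconv : Convex ℝ C) (h0 : (0 : E) ∈ interior C) (hk : 1 ≤ k) :
    HasPsdLift C k ↔ ∀ (v f : ℕ) (x : Fin v → E) (y : Fin f → E),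
      (∀ i, x i ∈ C.extremePoints ℝ) → (∀ j, y j ∈ (polarInner C).extremePoints ℝ) →
        HasPsdFactorization (fun i j => 1 - ⟪x i, y j⟫) k := by
  classical
  constructor
  · intro h v f x y hx hy
    obtain ⟨A, B, hA, hB, hAB⟩ := h.exists_psd_factorization_polarInner hk hCc.isBounded
    exact ⟨fun i => A (x i), fun j => B (y j), fun i => hA _ (extremePoints_subset (hx i)),
      fun j => hB _ (extremePoints_subset (hy j)),
      fun i j => (hAB _ (extremePoints_subset (hx i)) _ (extremePoints_subset (hy j))).symm⟩
  · intro h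
    -- the slack operator on `ext C × ext C°`, a matrix over these index sets with bounded entries
    obtain ⟨R, hR⟩ := hCc.isBounded.exists_norm_le
    obtain ⟨R', hR'⟩ := (isBounded_polarInner h0).exists_norm_le
    have hMle : ∀ (x : C.extremePoints ℝ) (y : (polarInner C).extremePoints ℝ),
        1 - ⟪(x : E), (y : E)⟫ ≤ 1 + max R 0 * R' := fun x y =>
      one_sub_inner_le_of_norm_le (fun z hz => (hR z hz).trans (le_max_left _ _)) hR'
        (le_max_right _ _) (extremePoints_subset x.2) (extremePoints_subset y.2)
    -- its finite submatrices have size-`k` psd factorizations (hypothesis, after enumeration)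
    have hfin : ∀ (s : Finset (C.extremePoints ℝ)) (t : Finset ((polarInner C).extremePoints ℝ)),
        HasPsdFactorization (fun (i : s) (j : t) =>
          1 - ⟪((i : C.extremePoints ℝ) : E), ((j : (polarInner C).extremePoints ℝ) : E)⟫) k := by
      intro s t
      have hfac := h s.card t.card (fun i => ((s.equivFin.symm i).1 : E))
        (fun j => ((t.equivFin.symm j).1 : E)) (fun i => (s.equivFin.symm i).1.2)
        fun j => (t.equivFin.symm j).1.2
      have h' := hfac.submatrix (fun i : s => s.equivFin i) (fun j : t => t.equivFin j)
      simpa only [Equiv.symm_apply_apply] using h'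
    obtain ⟨A₀, B₀, hA₀, hB₀, hAB₀⟩ := HasPsdFactorization.of_finite hMle hfin
    -- extend the factors to maps on `E` and apply Theorem 2.4 "⇐"
    refine hasPsdLift_of_psd_factorization hCc hCconv h0
      (A := fun x => if hx : x ∈ C.extremePoints ℝ then A₀ ⟨x, hx⟩ else 0)
      (B := fun y => if hy : y ∈ (polarInner C).extremePoints ℝ then B₀ ⟨y, hy⟩ else 0)
      (fun x hx => ?_) (fun y hy => ?_) fun x hx y hy => ?_
    · simp only [dif_pos hx]
      exact hA₀ _
    · simp only [dif_pos hy]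
      exact hB₀ _
    · simp only [dif_pos hx, dif_pos hy]
      exact (hAB₀ ⟨x, hx⟩ ⟨y, hy⟩).symm

/-- **Closures keep the psd-lift size** (consequence of GPT Thm. 2.4 and FGPRT Thm. 2.12): if a
bounded convex `C` with `0 ∈ int C` has a psd lift of size `k ≥ 1`, then so does its closure.
Proof: `cl C` is a convex body with `(cl C)° = C°`; a finite slack matrix `[1 − ⟪x_i, y_j⟫]` of
`cl C` (`x_i ∈ ext(cl C)`, `y_j ∈ ext(C°)`) is the entrywise limit of the matrices
`[1 − ⟪x_i^{(t)}, y_j⟫]`, `x_i^{(t)} ∈ C`, `x_i^{(t)} → x_i`, which factor through the Theorem 2.4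
maps `A, B` of `C`; psd rank `≤ k` is closed under limits (FGPRT Thm. 2.12, tree:
`FawziEtAl2015_thm212_holds`), and `hasPsdLift_iff_forall_finite_slackMatrix` concludes. (Not
printed in this form in the sources; a spectrahedral shadow need not be closed.)
[cite: GouveiaParriloThomas2013, Thm. 2.4 (§2, p05–p06)] [cite: FawziEtAl2015, Thm. 2.12 (p07–p08)] -/
theorem HasPsdLift.closure [FiniteDimensional ℝ E] {C : Set E} (hC : HasPsdLift C k) (hk : 1 ≤ k)
    (hbdd : Bornology.IsBounded C) (hconv : Convex ℝ C) (h0 : (0 : E) ∈ interior C) :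
    HasPsdLift (_root_.closure C) k := by
  classical
  have hDc : IsCompact (_root_.closure C) := hbdd.isCompact_closure
  have hDconv : Convex ℝ (_root_.closure C) := hconv.closure
  have hD0 : (0 : E) ∈ interior (_root_.closure C) := interior_mono subset_closure h0
  obtain ⟨A, B, hA, hB, hAB⟩ := hC.exists_psd_factorization_polarInner hk hbdd
  refine (hasPsdLift_iff_forall_finite_slackMatrix hDc hDconv hD0 hk).mpr fun v f x y hx hy => ?_
  -- `y_j ∈ (cl C)° ⊆ C°`
  have hyC : ∀ j, y j ∈ polarInner C := fun j z hz =>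
    (extremePoints_subset (hy j) : y j ∈ polarInner (_root_.closure C)) z (subset_closure hz)
  -- sequences `u i t → x i` inside `C`
  have hseq : ∀ i, ∃ u : ℕ → E, (∀ t, u t ∈ C) ∧ Filter.Tendsto u Filter.atTop (nhds (x i)) :=
    fun i => mem_closure_iff_seq_limit.mp (extremePoints_subset (hx i))
  choose u huC hu using hseq
  refine FawziEtAl2015_thm212_holds (Fin v) (Fin f) (fun t i j => 1 - ⟪u i t, y j⟫)
    (fun i j => 1 - ⟪x i, y j⟫) k (fun t => ?_) fun i j => ?_
  · exact ⟨fun i => A (u i t), fun j => B (y j), fun i => hA _ (huC i t), fun j => hB _ (hyC j),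
      fun i j => (hAB _ (huC i t) _ (hyC j)).symm⟩
  · exact tendsto_const_nhds.sub ((hu i).inner tendsto_const_nhds)

end FiniteSlackMatrices

/-! ### Translations, and the closure theorem for bodies with nonempty interior -/

section Translation

variable {W : Type*} [NormedAddCommGroup W] [NormedSpace ℝ W]

/-- **Translations keep psd-lift size** for bounded sets with two points: if `C = π(S^k_+ ∩ L)` is
bounded and not a singleton then `0 ∉ L` (`zero_notMem_of_psdLift_of_isBounded`), so there is a
linear functional `f` with `f ≡ 1` on `L`, and `v + C = π'(S^k_+ ∩ L)` with the LINEAR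
`π' X = f(X) v + π X`. (For cones — `0 ∈ L` — translation can change the size: `{0}` has a lift of
size `0`, `{v}` does not.) [cite: FawziEtAl2015, §3.1 eq. (3) (p09)]
[cite: GouveiaParriloThomas2013, Def. 2.1 (§2, p05)] -/
theorem HasPsdLift.image_const_add {C : Set W} (hC : HasPsdLift C k) (hbdd : Bornology.IsBounded C)
    (hnt : C.Nontrivial) (v : W) : HasPsdLift ((fun x => v + x) '' C) k := by
  classical
  obtain ⟨L, π, rfl⟩ := hC
  have h0 : (0 : Matrix (Fin k) (Fin k) ℝ) ∉ L := zero_notMem_of_psdLift_of_isBounded L π hbdd hnt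
  obtain ⟨_, ⟨X₁, hX₁, rfl⟩, -⟩ := hnt
  have hX₁dir : X₁ ∉ L.direction := fun h => h0 (by
    have h' := (AffineSubspace.vadd_mem_iff_mem_direction (-X₁) hX₁.2).mpr (L.direction.neg_mem h)
    rwa [vadd_eq_add, neg_add_cancel] at h')
  -- a linear functional `f ≡ 1` on `L`
  obtain ⟨f₀, hf₀X, hf₀V⟩ := Submodule.exists_dual_map_eq_bot_of_notMem hX₁dir inferInstance
  set f : Module.Dual ℝ (Matrix (Fin k) (Fin k) ℝ) := (f₀ X₁)⁻¹ • f₀ with hf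
  have hfX₁ : f X₁ = 1 := by
    rw [hf, LinearMap.smul_apply, smul_eq_mul, inv_mul_cancel₀ hf₀X]
  have hfV : ∀ D ∈ L.direction, f D = 0 := fun D hD => by
    have h : f₀ D ∈ Submodule.map f₀ L.direction := Submodule.mem_map_of_mem hD
    rw [hf₀V] at h
    rw [hf, LinearMap.smul_apply, (Submodule.mem_bot ℝ).mp h, smul_zero]
  have hfL : ∀ X ∈ L, f X = 1 := fun X hX => by
    have h := hfV _ (by
      have h' := AffineSubspace.vsub_mem_direction hX hX₁.2
      rwa [vsub_eq_sub] at h')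
    rw [map_sub, hfX₁, sub_eq_zero] at h
    exact h
  refine ⟨L, f.smulRight v + π, Set.ext fun y => ⟨?_, ?_⟩⟩
  · rintro ⟨_, ⟨X, hX, rfl⟩, rfl⟩
    refine ⟨X, hX, ?_⟩
    rw [LinearMap.add_apply, LinearMap.smulRight_apply, hfL X hX.2, one_smul]
  · rintro ⟨X, hX, rfl⟩
    refine ⟨π X, ⟨X, hX, rfl⟩, ?_⟩
    rw [LinearMap.add_apply, LinearMap.smulRight_apply, hfL X hX.2, one_smul]

end Translation

/-- **Closures keep the psd-lift size, translation-invariant form**: a bounded convex `C` with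
nonempty interior and a psd lift of size `k ≥ 1` has a closure with a psd lift of size `k`
(translate an interior point to the origin, `HasPsdLift.image_const_add`, apply
`HasPsdLift.closure`, translate back). [cite: GouveiaParriloThomas2013, Thm. 2.4 (§2, p05–p06)]
[cite: FawziEtAl2015, Thm. 2.12 (p07–p08)] -/
theorem HasPsdLift.closure_of_interior_nonempty [FiniteDimensional ℝ E] {C : Set E}
    (hC : HasPsdLift C k) (hk : 1 ≤ k) (hbdd : Bornology.IsBounded C) (hconv : Convex ℝ C)
    (hint : (interior C).Nonempty) : HasPsdLift (_root_.closure C) k := by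
  classical
  by_cases hsub : C.Subsingleton
  · rw [(hsub.finite.isClosed).closure_eq]
    exact hC
  obtain ⟨x₀, hx₀⟩ := hint
  have hnt : C.Nontrivial := Set.not_subsingleton_iff.mp hsub
  -- translate `x₀` to the origin
  set C' : Set E := (fun x => -x₀ + x) '' C with hC'
  have hT : ∀ s : Set E, (fun x => -x₀ + x) '' s = Homeomorph.addLeft (-x₀) '' s := fun s => rfl
  have hC'lift : HasPsdLift C' k := hC.image_const_add hbdd hnt (-x₀)
  have hC'bdd : Bornology.IsBounded C' := by
    obtain ⟨R, hR⟩ := hbdd.exists_norm_le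
    refine isBounded_iff_forall_norm_le.mpr ⟨‖x₀‖ + R, ?_⟩
    rintro _ ⟨x, hx, rfl⟩
    calc ‖-x₀ + x‖ ≤ ‖-x₀‖ + ‖x‖ := norm_add_le _ _
      _ ≤ ‖x₀‖ + R := by rw [norm_neg]; exact add_le_add le_rfl (hR x hx)
  have hC'conv : Convex ℝ C' := hconv.translate (-x₀)
  have hC'0 : (0 : E) ∈ interior C' := by
    have h : -x₀ + x₀ ∈ (fun x => -x₀ + x) '' interior C := ⟨x₀, hx₀, rfl⟩
    rw [neg_add_cancel, hT, (Homeomorph.addLeft (-x₀)).image_interior] at h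
    exact h
  have hcl : HasPsdLift (_root_.closure C') k := hC'lift.closure hk hC'bdd hC'conv hC'0
  -- translate back
  have hcl' := hcl.image_const_add hC'bdd.closure
    ((hnt.image (add_right_injective (-x₀))).mono subset_closure) x₀
  have hset : (fun x => x₀ + x) '' _root_.closure C' = _root_.closure C := by
    have hT' : (fun x : E => x₀ + x) = Homeomorph.addLeft x₀ := rfl
    rw [hT', (Homeomorph.addLeft x₀).image_closure, hC', Set.image_image]
    congr 1
    refine Set.ext fun y => ⟨?_, fun hy => ⟨y, hy, by simp⟩⟩
    rintro ⟨x, hx, rfl⟩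
    simpa using hx
  rwa [hset] at hcl'

end Literature.Combinatorics.Optimization
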